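import Summits.SmoothPoincare4.SmoothPoincare4.Theses.SymplecticOrigami
import Literature.Geometry.Symplectic.CanonicalClassSqAndAdjunctionReduction
import Literature.Geometry.Symplectic.CanonicalAdjunctionModuloSelfIntersection
import Literature.Geometry.Symplectic.HirzebruchSignatureAlmostComplexFour
import HarnessLib

/-!
# Route SymplecticOrigami · item `SymplecticChernPackage` (stmt-SmoothPoincare4-16627)

The route item `Theses.SymplecticOrigami.SymplecticChernPackage` — the Chern-number package of
closed symplectic `4`-manifolds: `∃ μ K`, (i) `b⁺(μ) ≥ 1`, (ii) `⟨K ⌣ K, [N]_μ⟩ = 2χ + 3σ(μ)`,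
(iii) non-torsion and adjunction `b₁(S) − 2 = σ·σ + K·σ` for symplectic surfaces — IS, character
for character, the tree's named Literature fact
`Literature.Geometry.Symplectic.canonicalClass_sq_and_adjunction_of_symplectic_four`
(McDuff–Salamon 2017, Rem. 4.1.10 eq. (4.1.7), Def. 4.1.4, §4.4, Ex. 4.4.5 eq. (4.4.5);
Gompf–Stipsicz 1999, §10.1): `symplecticChernPackage_iff` is `Iff.rfl`.

This file wires the item to the tree's proved reductions of that fact, so that the item closes in
one line the moment the residual printed inputs are discharged:

* `SymplecticChernPackage_of_canonicalClassSqAndAdjunction` — from the named fact itself;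
* `SymplecticChernPackage_of_hirzebruchWu_of_selfIntersection` — from (B) the Hirzebruch–Wu
  formula `hirzebruch_firstChernClass_sq_eq_almostComplex_four` (`c₁² = 2χ + 3σ` for closed almost
  complex `4`-manifolds, MS Rem. 4.1.10 (4.1.7): Hirzebruch's signature theorem + `⟨c₂, [N]⟩ = χ`)
  and (SI) the self-intersection formula `⟨c₁(ν_S), [S]_{GB}⟩ = σ·σ` for the symplectic normal
  bundle of a symplectic surface and its Gauss–Bonnet orientation (MS Ex. 4.4.5 with Thm. 2.7.5),
  through `canonicalClass_sq_and_adjunction_of_symplectic_four_of_hirzebruch_of_selfIntersection`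
  (`CanonicalAdjunctionModuloSelfIntersection.lean`; conjuncts (O), (i), (iii)(a) and the
  Gauss–Bonnet number `⟨c₁(TS), [S]_{GB}⟩ = 2 − b₁(S)` are theorems of the tree);
* `SymplecticChernPackage_of_signatureFormula_of_topChernNumber_of_selfIntersection` — (B) split
  further into the signature formula `3σ(μ) = ⟨c₁² − 2c₂, [N]_μ⟩` (MS Ex. 4.4.3 (v) eq. (4.4.3)) and
  the top Chern number `⟨c₂(TN, J), [N]_μ⟩ = χ(N)` (Milnor–Stasheff Cor. 11.12), through
  `hirzebruchWu_of_signatureFormula_of_topChernNumber`.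

All three are CONDITIONAL (named-fact / printed-input hypotheses); nothing is asserted.  The
consumer `OrigamiRung_of … hK …` (`Theorems/SymplecticOrigamiOrigamiRung.lean`) takes the Literature
name directly, which `symplecticChernPackage_iff` identifies with the item.
-/

namespace Summit.SmoothPoincare4.SmoothPoincare4.Theorems

open scoped Manifold ContDiff
open Literature.Geometry.Symplectic Literature.AlgebraicTopology.SingularHomology
open Literature.AlgebraicTopology.CharacteristicClasses
open Literature.Geometry.Kaehler (MForm IsSmoothForm IsClosedForm)

/-- **The item is the Literature fact, verbatim**: `SymplecticChernPackage` unfolds, character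
for character, to `canonicalClass_sq_and_adjunction_of_symplectic_four` (McDuff–Salamon 2017,
Rem. 4.1.10 eq. (4.1.7), Ex. 4.4.5 eq. (4.4.5)); the same `Iff.rfl` as
`symplecticChernPackage_iff_canonicalClass` of `Theorems/SymplecticOrigamiOrigamiRungGlue.lean`,
restated here to keep this file's imports light. [cite: McDuffSalamon2017, Rem. 4.1.10 eq. (4.1.7); Ex. 4.4.5 eq. (4.4.5)] -/
theorem symplecticChernPackage_iff :
    Theses.SymplecticOrigami.SymplecticChernPackage ↔
      Literature.Geometry.Symplectic.canonicalClass_sq_and_adjunction_of_symplectic_four :=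
  Iff.rfl

/-- **`SymplecticChernPackage` from the named fact** `canonicalClass_sq_and_adjunction_of_symplectic_four`
(the day `…_holds` lands, `SymplecticChernPackage_of_canonicalClassSqAndAdjunction …_holds` closes
the item). [cite: McDuffSalamon2017, Rem. 4.1.10 eq. (4.1.7); Ex. 4.4.5 eq. (4.4.5)] -/
theorem SymplecticChernPackage_of_canonicalClassSqAndAdjunction
    (hK : Literature.Geometry.Symplectic.canonicalClass_sq_and_adjunction_of_symplectic_four) :
    Theses.SymplecticOrigami.SymplecticChernPackage :=
  symplecticChernPackage_iff.2 hK

/-- **`SymplecticChernPackage` from Hirzebruch–Wu and the self-intersection formula.**  Granted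
(B) `hirzebruch_firstChernClass_sq_eq_almostComplex_four` (`⟨c₁ ⌣ c₁, [N]_μ⟩ = 2χ + 3σ(μ)` for a
closed connected almost complex `4`-manifold with the orientation induced by `J`; McDuff–Salamon
Rem. 4.1.10 eq. (4.1.7)) and (SI): for every closed connected symplectic `(N, s)` with symplectic
orientation `μ`, every `s`-compatible `J` and every compact connected symplectic surface
`b : S ↪ N`, if `σ` is Poincaré dual to `b_*[S]_{GB}` (Gauss–Bonnet orientation of `b^*s`) then
`⟨c₁(ν_S), [S]_{GB}⟩ = ⟨b^*σ, [S]_{GB}⟩` for the symplectic normal bundle `ν_S` (McDuff–Salamon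
Ex. 4.4.5 with Thm. 2.7.5, "`c₁(νΣ) = Σ·Σ`"), the item holds — by the tree's
`canonicalClass_sq_and_adjunction_of_symplectic_four_of_hirzebruch_of_selfIntersection`, in which
(O) the symplectic orientation, (i) `b⁺ ≥ 1`, (iii)(a) non-torsion and the Gauss–Bonnet number
`⟨c₁(TS, j), [S]_{GB}⟩ = 2 − b₁(S)` are proved. [cite: McDuffSalamon2017, Rem. 4.1.10 eq. (4.1.7); Ex. 4.4.5 eq. (4.4.5); Thm. 2.7.5] -/
theorem SymplecticChernPackage_of_hirzebruchWu_of_selfIntersection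
    (hHW : hirzebruch_firstChernClass_sq_eq_almostComplex_four)
    (hSI : ∀ (N : Type) [TopologicalSpace N] [T2Space N] [SecondCountableTopology N]
      [CompactSpace N] [ConnectedSpace N] [ChartedSpace (EuclideanSpace ℝ (Fin 4)) N]
      [IsManifold (𝓡 4) ∞ N] (s : MForm (𝓡 4) N ℝ 2) (hs : IsSmoothForm s) (hcl : IsClosedForm s)
      (hsnd : ∀ x (v : TangentSpace (𝓡 4) x), v ≠ 0 → ∃ w : TangentSpace (𝓡 4) x, s x ![v, w] ≠ 0)
      (μ : HomologicalOrientation ℤ N 4), μ.IsSymplecticOrientationOf s hs hcl →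
      ∀ (J : AlmostComplexStructure (𝓡 4) ∞ N) (hJ : J.IsCompatibleWith s)
        (S : Type) [TopologicalSpace S] [CompactSpace S] [ConnectedSpace S]
        [ChartedSpace (EuclideanSpace ℝ (Fin 2)) S] [IsManifold (𝓡 2) ∞ S] [T2Space S] (b : S → N)
        (hb : Manifold.IsSmoothEmbedding (𝓡 2) (𝓡 4) ∞ b)
        (hbnd : ∀ y (v : TangentSpace (𝓡 2) y), v ≠ 0 → ∃ w : TangentSpace (𝓡 2) y,
          s (b y) ![mfderiv (𝓡 2) (𝓡 4) b y v, mfderiv (𝓡 2) (𝓡 4) b y w] ≠ 0)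
        (σ : ↥(singularCohomology ℤ ℤ N 2)),
        poincareDualityMap μ two_add_two_eq_four σ =
          singularHomology.map ℤ ℤ ⟨b, hb.isEmbedding.continuous⟩ 2
            (gbSurfaceOrientation hs hb hbnd).fundamentalClass →
        kroneckerPairing ℤ ℤ S 2
            (degCast ℤ (mul_one 2) (chernClassZ
              (SymplecticSplitting.symplecticNormalBundle (IS := 𝓡 2) (J := J) (b := b) hs hsnd
                hJ.isTamedBy hb.contMDiff
                (fun y ↦ (SymplecticSplitting.pullbackNondegAt_iff s b y).2 (hbnd y))
                finrank_euclideanSpace_four_eq_two_add_two) 1))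
            (gbSurfaceOrientation hs hb hbnd).fundamentalClass =
          kroneckerPairing ℤ ℤ S 2 (singularCohomology.map ℤ ℤ ⟨b, hb.isEmbedding.continuous⟩ 2 σ)
            (gbSurfaceOrientation hs hb hbnd).fundamentalClass) :
    Theses.SymplecticOrigami.SymplecticChernPackage :=
  symplecticChernPackage_iff.2
    (canonicalClass_sq_and_adjunction_of_symplectic_four_of_hirzebruch_of_selfIntersection hHW hSI)

/-- **`SymplecticChernPackage` from the signature formula, the top Chern number and the
self-intersection formula**: (B) of the previous reduction split by the tree's
`hirzebruchWu_of_signatureFormula_of_topChernNumber` into Hirzebruch's signature formula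
`3σ(μ) = ⟨c₁² − 2c₂, [N]_μ⟩` for closed almost complex `4`-manifolds (McDuff–Salamon Ex. 4.4.3 (v)
eq. (4.4.3)) and the top Chern number `⟨c₂(TN, J), [N]_μ⟩ = χ(N)` for the orientation induced by
`J` (Milnor–Stasheff Cor. 11.12). [cite: McDuffSalamon2017, Ex. 4.4.3 (v) eq. (4.4.3); Rem. 4.1.10 eq. (4.1.7); Ex. 4.4.5 eq. (4.4.5)]
[cite: MilnorStasheff1974, Cor. 11.12] -/
theorem SymplecticChernPackage_of_signatureFormula_of_topChernNumber_of_selfIntersection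
    (h443 : ∀ (N : Type) [TopologicalSpace N] [T2Space N] [SecondCountableTopology N]
      [CompactSpace N] [ConnectedSpace N] [ChartedSpace (EuclideanSpace ℝ (Fin 4)) N]
      [IsManifold (𝓡 4) ∞ N] (J : AlmostComplexStructure (𝓡 4) ∞ N)
      (μ : HomologicalOrientation ℤ N 4),
      3 * μ.signature =
        cupPairing μ two_add_two_eq_four J.firstChernClass J.firstChernClass -
          2 * kroneckerPairing ℤ ℤ N 4
            (Literature.AlgebraicTopology.CharacteristicClasses.degCast ℤ (by norm_num : 2 * 2 = 4)
              (J.chernClass 2)) μ.fundamentalClass)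
    (hc₂ : ∀ (N : Type) [TopologicalSpace N] [T2Space N] [SecondCountableTopology N]
      [CompactSpace N] [ConnectedSpace N] [ChartedSpace (EuclideanSpace ℝ (Fin 4)) N]
      [IsManifold (𝓡 4) ∞ N] (J : AlmostComplexStructure (𝓡 4) ∞ N)
      (μ : HomologicalOrientation ℤ N 4), μ.IsComplexOrientationOf J →
      kroneckerPairing ℤ ℤ N 4
          (Literature.AlgebraicTopology.CharacteristicClasses.degCast ℤ (by norm_num : 2 * 2 = 4)
            (J.chernClass 2)) μ.fundamentalClass = relEuler ℤ ℤ N ∅)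
    (hSI : ∀ (N : Type) [TopologicalSpace N] [T2Space N] [SecondCountableTopology N]
      [CompactSpace N] [ConnectedSpace N] [ChartedSpace (EuclideanSpace ℝ (Fin 4)) N]
      [IsManifold (𝓡 4) ∞ N] (s : MForm (𝓡 4) N ℝ 2) (hs : IsSmoothForm s) (hcl : IsClosedForm s)
      (hsnd : ∀ x (v : TangentSpace (𝓡 4) x), v ≠ 0 → ∃ w : TangentSpace (𝓡 4) x, s x ![v, w] ≠ 0)
      (μ : HomologicalOrientation ℤ N 4), μ.IsSymplecticOrientationOf s hs hcl →
      ∀ (J : AlmostComplexStructure (𝓡 4) ∞ N) (hJ : J.IsCompatibleWith s)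
        (S : Type) [TopologicalSpace S] [CompactSpace S] [ConnectedSpace S]
        [ChartedSpace (EuclideanSpace ℝ (Fin 2)) S] [IsManifold (𝓡 2) ∞ S] [T2Space S] (b : S → N)
        (hb : Manifold.IsSmoothEmbedding (𝓡 2) (𝓡 4) ∞ b)
        (hbnd : ∀ y (v : TangentSpace (𝓡 2) y), v ≠ 0 → ∃ w : TangentSpace (𝓡 2) y,
          s (b y) ![mfderiv (𝓡 2) (𝓡 4) b y v, mfderiv (𝓡 2) (𝓡 4) b y w] ≠ 0)
        (σ : ↥(singularCohomology ℤ ℤ N 2)),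
        poincareDualityMap μ two_add_two_eq_four σ =
          singularHomology.map ℤ ℤ ⟨b, hb.isEmbedding.continuous⟩ 2
            (gbSurfaceOrientation hs hb hbnd).fundamentalClass →
        kroneckerPairing ℤ ℤ S 2
            (degCast ℤ (mul_one 2) (chernClassZ
              (SymplecticSplitting.symplecticNormalBundle (IS := 𝓡 2) (J := J) (b := b) hs hsnd
                hJ.isTamedBy hb.contMDiff
                (fun y ↦ (SymplecticSplitting.pullbackNondegAt_iff s b y).2 (hbnd y))
                finrank_euclideanSpace_four_eq_two_add_two) 1))
            (gbSurfaceOrientation hs hb hbnd).fundamentalClass =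
          kroneckerPairing ℤ ℤ S 2 (singularCohomology.map ℤ ℤ ⟨b, hb.isEmbedding.continuous⟩ 2 σ)
            (gbSurfaceOrientation hs hb hbnd).fundamentalClass) :
    Theses.SymplecticOrigami.SymplecticChernPackage :=
  SymplecticChernPackage_of_hirzebruchWu_of_selfIntersection
    (hirzebruchWu_of_signatureFormula_of_topChernNumber h443 hc₂) hSI

end Summit.SmoothPoincare4.SmoothPoincare4.Theorems
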